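import Summits.NavierStokesRegularity.NavierStokesRegularity.Theorems.TypeILiouvilleTypeIliouvilleNoTypeIIEternalSplitModL
import Literature.Analysis.FluidPDE.TaoEnstrophyLocalisationProofs
import HarnessLib

/-!
# EEL′ on the STEADY stratum, unconditionally: the scaled dissipation `E` and the scaled energy `A`
# kill every time-independent field (crux `TypeIliouvilleNoTypeII`, stmt-NavierStokesRegularity-0056;
# rigidity residual EEL′ of the pressure-free eternal split)

Helper file (theorems only).  The pressure-free eternal energy Liouville statement EEL′ (hypothesis
`hEEL` of `EternalSplit.typeIliouvilleNoTypeII_of_pressureFreeSlab_of_eternalLiouville`: a bounded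
eternal Oseen-mild smooth divergence-free `v`, `‖v‖ ≤ 2`, with Albritton–Barker's `A`, `C`, `E`
bounded by a finite `I` on ALL parabolic balls, has `v(0,0) = 0`) follows from KNSS's (L)
(`eternalLiouvillePressureFree_of_liouvilleL`, file `…EternalSplitModL.lean`).  KNSS's (L) itself is
OPEN already for bounded STEADY flows (Koch–Nadirashvili–Seregin–Šverák 2009, p. 9).  This file
records that on exactly that stratum EEL′ is ELEMENTARY and needs neither (L) nor the equations:
for a time-independent field `V`,

  `E(∇V; Q_r(t₀, x₀)) = r · ∫_{B_r(x₀)} |∇V|²_F`   (`cknE_steady`),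

so `E ≤ I < ∞` on all balls forces `∫_{B_r(x₀)} |∇V|²_F ≤ I/r → 0`, i.e. `∇V ≡ 0`
(`steady_fderiv_eq_zero_of_cknE_le`); then `V` is constant and the `A`-bound kills the constant
(`slice_eq_zero_of_const_of_cknAEss_le`).  Main statements:

* `steady_eq_zero_of_cknAEss_le_of_cknE_le` — a `C¹` field `V : ℝ³ → ℝ³` with
  `A((s,y) ↦ V y; Q) ≤ I` and `E((s,y) ↦ ∇V y; Q) ≤ I` on all parabolic balls, `I ≠ ∞`, vanishes;
* `eternalLiouvillePressureFree_steady` — EEL′ in the exact `hEEL` hypothesis shape, for fields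
  `v (s, y) = V y` constant in time (the Oseen-mild / divergence-free / `‖v‖ ≤ 2` hypotheses are
  accepted and NOT used).

WHAT THIS IS NOT: not NS; not (L) for steady flows (no Liouville theorem for bounded steady
Navier–Stokes flows is claimed — the `E`-bound hypothesis does all the work).
-/

noncomputable section

-- the summit and its single problem share the name `NavierStokesRegularity` (D-0017 nested layout)
set_option linter.dupNamespace false

open Set Function Filter Topology MeasureTheory Metric
open scoped NNReal ENNReal

namespace Summit.NavierStokesRegularity.NavierStokesRegularity.Theorems.TypeIliouvilleNoTypeII.TypeIIZoom

open Literature.Analysis Literature.Analysis.FluidPDE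

/-! ## Space–time integrals of time-independent integrands -/

/-- A time-independent integrand over a product `(a, b) × B`:
`∫∫_{(a,b) × B} f(y) = |(a, b)| · ∫_B f`. [folklore] -/
theorem setLIntegral_Ioo_prod_of_timeIndependent {f : EuclideanSpace ℝ (Fin 3) → ℝ≥0∞}
    (hf : Measurable f) (a b : ℝ) (B : Set (EuclideanSpace ℝ (Fin 3))) :
    ∫⁻ q in Ioo a b ×ˢ B, f q.2 = volume (Ioo a b) * ∫⁻ y in B, f y := by
  have hμ : (volume : Measure (ℝ × EuclideanSpace ℝ (Fin 3))).restrict (Ioo a b ×ˢ B) =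
      (volume.restrict (Ioo a b)).prod (volume.restrict B) := by
    rw [Measure.volume_eq_prod, Measure.prod_restrict]
  rw [hμ, lintegral_prod (fun q : ℝ × EuclideanSpace ℝ (Fin 3) => f q.2)
    (hf.comp measurable_snd).aemeasurable]
  simp only [lintegral_const, Measure.restrict_apply_univ, mul_comm]

/-- The scaling constant `r⁻¹ · r² = r` in `ℝ≥0∞`, `r > 0`. [folklore] -/
theorem inv_ofReal_mul_ofReal_sq {r : ℝ} (hr : 0 < r) :
    (ENNReal.ofReal r)⁻¹ * ENNReal.ofReal (r ^ 2) = ENNReal.ofReal r := by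
  have hr0 : ENNReal.ofReal r ≠ 0 := by simpa using hr
  rw [ENNReal.ofReal_pow hr.le, pow_two, ← mul_assoc,
    ENNReal.inv_mul_cancel hr0 ENNReal.ofReal_ne_top, one_mul]

/-- **The scaled dissipation of a time-independent gradient field**:
`E(G; Q_r(z)) = r · ∫_{B_r(z.2)} |G|²_F` for `G` constant in time and `r > 0`. [folklore] -/
theorem cknE_steady
    {G : EuclideanSpace ℝ (Fin 3) → EuclideanSpace ℝ (Fin 3) →L[ℝ] EuclideanSpace ℝ (Fin 3)}
    (hG : Measurable fun y => ENNReal.ofReal (frobeniusNormSq (G y))) {r : ℝ} (hr : 0 < r)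
    (z : ℝ × EuclideanSpace ℝ (Fin 3)) :
    cknE r z (fun _ y => G y) =
      ENNReal.ofReal r * ∫⁻ y in ball z.2 r, ENNReal.ofReal (frobeniusNormSq (G y)) := by
  unfold cknE parabolicCylinder
  rw [setLIntegral_Ioo_prod_of_timeIndependent hG, Real.volume_Ioo,
    show z.1 - (z.1 - r ^ 2) = r ^ 2 by ring, ← mul_assoc, inv_ofReal_mul_ofReal_sq hr]

/-! ## The `E`-bound kills the gradient of a steady field -/

/-- **A uniform bound on the scaled dissipation of a steady `C¹` field forces `∇V ≡ 0`.**  If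
`E((s,y) ↦ ∇V y; Q_r(z)) ≤ I ≠ ∞` for every parabolic ball, then `r ∫_{B_r(x₀)} |∇V|²_F ≤ I` for all
`r`, so the (nondecreasing in `r`) ball integrals vanish, and with them the continuous integrand.
[folklore] -/
theorem steady_fderiv_eq_zero_of_cknE_le {V : EuclideanSpace ℝ (Fin 3) → EuclideanSpace ℝ (Fin 3)}
    (hV : ContDiff ℝ 1 V) {I : ℝ≥0∞} (hI : I ≠ ⊤)
    (hE : ∀ r : ℝ, 0 < r → ∀ z : ℝ × EuclideanSpace ℝ (Fin 3),
      cknE r z (fun _ y => fderiv ℝ V y) ≤ I) (x₀ : EuclideanSpace ℝ (Fin 3)) :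
    fderiv ℝ V x₀ = 0 := by
  -- the integrand `|∇V|²_F` is continuous and nonnegative
  have hgc : Continuous fun y => ENNReal.ofReal (frobeniusNormSq (fderiv ℝ V y)) :=
    ENNReal.continuous_ofReal.comp (continuous_frobeniusNormSq_fderiv hV one_ne_zero)
  have hgm : Measurable fun y => ENNReal.ofReal (frobeniusNormSq (fderiv ℝ V y)) := hgc.measurable
  by_contra hne
  -- at `x₀` the integrand is positive, hence `> c > 0` on a small ball
  have hpos : 0 < ENNReal.ofReal (frobeniusNormSq (fderiv ℝ V x₀)) := by
    have h1 : 0 < ‖fderiv ℝ V x₀‖ := norm_pos_iff.2 hne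
    exact ENNReal.ofReal_pos.2 (lt_of_lt_of_le (by positivity) (sq_opNorm_le_frobeniusNormSq _))
  set c : ℝ≥0∞ := ENNReal.ofReal (frobeniusNormSq (fderiv ℝ V x₀)) / 2 with hc
  have hc0 : c ≠ 0 := (ENNReal.half_pos hpos.ne').ne'
  obtain ⟨δ, hδ, hball⟩ : ∃ δ > 0, ∀ y ∈ ball x₀ δ,
      c < ENNReal.ofReal (frobeniusNormSq (fderiv ℝ V y)) := by
    have hlt : c < ENNReal.ofReal (frobeniusNormSq (fderiv ℝ V x₀)) :=
      ENNReal.half_lt_self hpos.ne' ENNReal.ofReal_ne_top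
    have hev : ∀ᶠ y in 𝓝 x₀, c < ENNReal.ofReal (frobeniusNormSq (fderiv ℝ V y)) :=
      hgc.continuousAt.eventually (lt_mem_nhds hlt)
    obtain ⟨δ, hδ, h⟩ := Metric.eventually_nhds_iff.1 hev
    exact ⟨δ, hδ, fun y hy => h hy⟩
  -- the small-ball integral `J` is positive
  have hJpos : (∫⁻ y in ball x₀ δ, ENNReal.ofReal (frobeniusNormSq (fderiv ℝ V y))) ≠ 0 := by
    have hle : c * volume (ball x₀ δ) ≤
        ∫⁻ y in ball x₀ δ, ENNReal.ofReal (frobeniusNormSq (fderiv ℝ V y)) := by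
      rw [← setLIntegral_const]
      exact setLIntegral_mono hgm fun y hy => (hball y hy).le
    intro h0
    rw [h0, le_zero_iff] at hle
    exact mul_ne_zero hc0 (measure_ball_pos volume x₀ hδ).ne' hle
  -- but `J · r ≤ r · ∫_{B_r} |∇V|²_F = E(∇V; Q_r(0, x₀)) ≤ I` for every `r ≥ δ`
  have key : ∀ r : ℝ, δ ≤ r →
      (∫⁻ y in ball x₀ δ, ENNReal.ofReal (frobeniusNormSq (fderiv ℝ V y))) * ENNReal.ofReal r ≤
        I := by
    intro r hr
    have hr0 : 0 < r := hδ.trans_le hr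
    have hmono : (∫⁻ y in ball x₀ δ, ENNReal.ofReal (frobeniusNormSq (fderiv ℝ V y))) ≤
        ∫⁻ y in ball x₀ r, ENNReal.ofReal (frobeniusNormSq (fderiv ℝ V y)) :=
      lintegral_mono_set (ball_subset_ball hr)
    have hEq := cknE_steady (G := fderiv ℝ V) hgm hr0 ((0 : ℝ), x₀)
    calc (∫⁻ y in ball x₀ δ, ENNReal.ofReal (frobeniusNormSq (fderiv ℝ V y))) * ENNReal.ofReal r
        ≤ ENNReal.ofReal r *
            ∫⁻ y in ball x₀ r, ENNReal.ofReal (frobeniusNormSq (fderiv ℝ V y)) := by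
          rw [mul_comm]; exact mul_le_mul' le_rfl hmono
      _ = cknE r ((0 : ℝ), x₀) (fun _ y => fderiv ℝ V y) := hEq.symm
      _ ≤ I := hE r hr0 _
  have hlim : Tendsto (fun r : ℝ =>
      (∫⁻ y in ball x₀ δ, ENNReal.ofReal (frobeniusNormSq (fderiv ℝ V y))) * ENNReal.ofReal r)
      atTop (𝓝 ⊤) := by
    have h' := ENNReal.Tendsto.const_mul
      (a := ∫⁻ y in ball x₀ δ, ENNReal.ofReal (frobeniusNormSq (fderiv ℝ V y)))
      ENNReal.tendsto_ofReal_atTop (Or.inl ENNReal.top_ne_zero)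
    rwa [ENNReal.mul_top hJpos] at h'
  obtain ⟨r, hIr, hr⟩ := ((hlim.eventually_const_lt hI.lt_top).and (eventually_ge_atTop δ)).exists
  exact lt_irrefl I (hIr.trans_le (key r hr))

/-! ## EEL′ on the steady stratum -/

/-- **Steady fields with bounded `A` and `E` vanish.**  A `C¹` field `V : ℝ³ → ℝ³` whose
time-independent space–time extension has scaled local energy `A` and scaled dissipation `E` bounded
by some `I ≠ ∞` on every parabolic ball is identically zero: `∇V ≡ 0` by
`steady_fderiv_eq_zero_of_cknE_le`, so `V` is constant, and a constant with bounded `A` is zero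
(`slice_eq_zero_of_const_of_cknAEss_le`). [folklore] -/
theorem steady_eq_zero_of_cknAEss_le_of_cknE_le
    {V : EuclideanSpace ℝ (Fin 3) → EuclideanSpace ℝ (Fin 3)} (hV : ContDiff ℝ 1 V) {I : ℝ≥0∞}
    (hI : I ≠ ⊤)
    (hA : ∀ r : ℝ, 0 < r → ∀ z : ℝ × EuclideanSpace ℝ (Fin 3),
      cknAEss r z (fun _ y => V y) ≤ I)
    (hE : ∀ r : ℝ, 0 < r → ∀ z : ℝ × EuclideanSpace ℝ (Fin 3),
      cknE r z (fun _ y => fderiv ℝ V y) ≤ I) (x : EuclideanSpace ℝ (Fin 3)) :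
    V x = 0 := by
  have h0 : ∀ y, fderiv ℝ V y = 0 := steady_fderiv_eq_zero_of_cknE_le hV hI hE
  have hconst : ∀ (s : ℝ) (y : EuclideanSpace ℝ (Fin 3)), (fun (_ : ℝ) y => V y) s y =
      (fun (_ : ℝ) y => V y) s 0 :=
    fun _ y => is_const_of_fderiv_eq_zero (hV.differentiable one_ne_zero) h0 y 0
  exact slice_eq_zero_of_const_of_cknAEss_le (v := fun _ y => V y) continuous_const hconst hI hA 0 x

/-- **EEL′ holds on the steady stratum** — in the exact hypothesis shape of
`EternalSplit.typeIliouvilleNoTypeII_of_pressureFreeSlab_of_eternalLiouville` (`hEEL`), restricted to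
fields `v(s, y) = V y` that do not depend on time: such a `v` with `A`, `C`, `E` bounded by a finite
`I` on all parabolic balls has `v(0, 0) = 0` (indeed `V ≡ 0`).  The Oseen-mild, divergence-free and
`‖v‖ ≤ 2` hypotheses are part of the shape and are NOT used: on the stratum where KNSS's (L) is open
(bounded steady flows), the energy currency decides by itself. [cite: KochNadirashviliSereginSverak2009, §1 p. 9 (the steady case of (L) is open) (arXiv:0709.3599)] -/
theorem eternalLiouvillePressureFree_steady
    (V : EuclideanSpace ℝ (Fin 3) → EuclideanSpace ℝ (Fin 3))
    (hv : ContDiff ℝ (⊤ : ℕ∞) (uncurry fun (_ : ℝ) y => V y))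
    (_hdiv : ∀ t : ℝ, VectorCalculus.IsDivFree ((fun (_ : ℝ) y => V y) t))
    (_hmild : ∀ s t : ℝ, s < t → ∀ x, (fun (_ : ℝ) y => V y) t x =
      heatFlow ((fun (_ : ℝ) y => V y) s) (t - s) x -
        oseenDuhamel 1 s (fun (_ : ℝ) y => V y) (fun (_ : ℝ) y => V y) t x)
    (_hbd : ∀ (t : ℝ) x, ‖(fun (_ : ℝ) y => V y) t x‖ ≤ 2)
    (hI : ∃ I : ℝ≥0∞, I ≠ ⊤ ∧ ∀ r : ℝ, 0 < r → ∀ z : ℝ × EuclideanSpace ℝ (Fin 3),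
      cknAEss r z (fun (_ : ℝ) y => V y) ≤ I ∧ cknC r z (fun (_ : ℝ) y => V y) ≤ I ∧
      cknE r z (fun s y => fderiv ℝ ((fun (_ : ℝ) y => V y) s) y) ≤ I) :
    (fun (_ : ℝ) y => V y) 0 0 = 0 := by
  obtain ⟨I, hItop, hball⟩ := hI
  have hV1 : ContDiff ℝ 1 V :=
    ((hv.comp (contDiff_prodMk_right (0 : ℝ))).of_le (by simp))
  exact steady_eq_zero_of_cknAEss_le_of_cknE_le hV1 hItop (fun r hr z => (hball r hr z).1)
    (fun r hr z => (hball r hr z).2.2) 0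

end Summit.NavierStokesRegularity.NavierStokesRegularity.Theorems.TypeIliouvilleNoTypeII.TypeIIZoom

end
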